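import Literature.NumberTheory.Automorphic.GLnAdelicStructure
import Mathlib.LinearAlgebra.Matrix.GeneralLinearGroup.FinTwo
import HarnessLib

/-!
# The shell subgroups `J_{r,c} ≤ GL_2(F)` of a discretely valued field and their Iwahori factorisation

Topic `NumberTheory/Automorphic`; namespace `Literature.NumberTheory.Automorphic`. Groundwork for the
finite-place half of the Kirillov `L²`-bound of the smoothed Whittaker coefficient on `GL_2` (the
`n ≤ 2` case of the named fact `JacquetShalika1981_partialPairL_pole_of_eq_conj`), local algebraic part.

For a field `F` valued in `ℤ ∪ {∞}` (Mathlib `Valued F (WithZero (Multiplicative ℤ))`, `|x| = exp(-ord x)`),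
integers `r` and `c ≥ 1`, the **shell subgroup**

  `J_{r,c} = { g ∈ GL_2(F) : |g₁₁ - 1|, |g₂₂ - 1| ≤ e^{-c}, |g₁₂| ≤ e^{r}, |g₂₁| ≤ e^{-c-r} }`
  (`shellSubgroup r c`, i.e. `(1 + 𝔭^c, 𝔭^{-r}; 𝔭^{c+r}, 1 + 𝔭^c)`)

is a subgroup (`det ∈ 1 + 𝔭^c`); it contains the unipotents `n(x)` (Mathlib `Matrix.GeneralLinearGroup.upperRightHom x`), `|x| ≤ e^r`, and every
`j ∈ J_{r,c}` factors as `j = n(x) b` with `x = j₁₂ / j₂₂` and `b` lower triangular,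
`b₂₂ = j₂₂`, `b₂₁ = j₂₁`, `|b₁₁ - 1| ≤ e^{-c}` (`shell_factorisation`); conjugating a lower triangular
element by the torus `a(t) = diag(t, 1)` (the tree's `glDiagonal 2 F ![t, 1]`) multiplies its `(2,1)` entry by `t`
(`ent_aInv_mul_mul_a`), so that `a(t)⁻¹ b a(t)` lies in the principal congruence subgroup
`K(e^{-c₀})` (`valuedCongruenceSubgroup`) as soon as `|t| ≤ e^{-m}` with `m ≥ -r - c₀` and `c ≥ 2 c₀`
(`aInv_mul_mul_a_mem_valuedCongruenceSubgroup`). Finally `K(e^{-N}) ≤ J_{r,c}` for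
`N ≥ max(c + r, c, -r)` and the map `j ↦ j₁₂` is additive on `J_{r,c}` modulo `𝔭^{c-r}`
(`valued_mul_entry_sub_le`), which makes `j ↦ ψ(j₁₂)` a character of `J_{r,c}` for every additive
character `ψ` trivial on `𝔭^{c-r}`. Pure algebra; all proofs complete (Bushnell–Henniart (2006), §12,
the groups `U_𝔄ⁿ` of a chain order; standard). No named facts.

## References

* C. J. Bushnell, G. Henniart, *The local Langlands conjecture for GL(2)*, Grundlehren 335,
  Springer (2006), §12 [BushnellHenniart2006].
-/

noncomputable section

open scoped MatrixGroups
open Matrix WithZero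

namespace Literature.NumberTheory.Automorphic

namespace ShellGL2

variable {F : Type*} [Field F] [Valued F (WithZero (Multiplicative ℤ))]

local notation "𝓋" => (Valued.v : Valuation F (WithZero (Multiplicative ℤ)))

/-! ### Valuation bookkeeping -/

/-- `e^{-c} < 1` for `c ≥ 1`. [folklore] -/
theorem exp_neg_lt_one {c : ℤ} (hc : 1 ≤ c) : exp (-c) < (1 : WithZero (Multiplicative ℤ)) := by
  rw [← exp_zero, exp_lt_exp]; omega

/-- `|a - 1| ≤ e^{-c}`, `c ≥ 1` gives `|a| = 1`. [folklore] -/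
theorem v_eq_one_of_sub_one {a : F} {c : ℤ} (hc : 1 ≤ c) (h : 𝓋 (a - 1) ≤ exp (-c)) : 𝓋 a = 1 := by
  have h1 : 𝓋 (a - 1) < 1 := h.trans_lt (exp_neg_lt_one hc)
  have := Valuation.map_one_add_of_lt 𝓋 h1
  rwa [add_sub_cancel] at this

/-- Ultrametric inequality for three terms. [folklore] -/
theorem v_add_add_le {x y z : F} {b : WithZero (Multiplicative ℤ)} (hx : 𝓋 x ≤ b) (hy : 𝓋 y ≤ b) (hz : 𝓋 z ≤ b) :
    𝓋 (x + y + z) ≤ b :=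
  (Valuation.map_add _ _ _).trans (max_le ((Valuation.map_add _ _ _).trans (max_le hx hy)) hz)

/-- Two terms. [folklore] -/
theorem v_add_le {x y : F} {b : WithZero (Multiplicative ℤ)} (hx : 𝓋 x ≤ b) (hy : 𝓋 y ≤ b) : 𝓋 (x + y) ≤ b :=
  (Valuation.map_add _ _ _).trans (max_le hx hy)

/-- Products. [folklore] -/
theorem v_mul_le {x y : F} {a b : WithZero (Multiplicative ℤ)} (hx : 𝓋 x ≤ a) (hy : 𝓋 y ≤ b) : 𝓋 (x * y) ≤ a * b := by
  rw [map_mul]; exact mul_le_mul' hx hy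

/-! ### The shell subgroup -/

/-- The entry `g_{ij}` of `g ∈ GL_2(F)`. [folklore] -/
abbrev ent (g : GL (Fin 2) F) (i j : Fin 2) : F := (g : Matrix (Fin 2) (Fin 2) F) i j

/-- The shell conditions. [cite: BushnellHenniart2006, §12] -/
def ShellCond (r c : ℤ) (g : GL (Fin 2) F) : Prop :=
  𝓋 (ent g 0 0 - 1) ≤ exp (-c) ∧ 𝓋 (ent g 1 1 - 1) ≤ exp (-c) ∧ 𝓋 (ent g 0 1) ≤ exp r ∧ 𝓋 (ent g 1 0) ≤ exp (-c - r)

omit [Valued F (WithZero (Multiplicative ℤ))] in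
/-- Auxiliary. [folklore] -/
theorem ent_mul (g h : GL (Fin 2) F) (i j : Fin 2) : ent (g * h) i j = ent g i 0 * ent h 0 j + ent g i 1 * ent h 1 j := by
  simp [ent, Matrix.mul_apply, Fin.sum_univ_two]

omit [Valued F (WithZero (Multiplicative ℤ))] in
/-- Auxiliary. [folklore] -/
theorem ent_one (i j : Fin 2) : ent (1 : GL (Fin 2) F) i j = if i = j then 1 else 0 := by
  simp [ent, Matrix.one_apply]

omit [Valued F (WithZero (Multiplicative ℤ))] in
/-- The determinant of `g` in terms of entries. [folklore] -/
theorem det_eq (g : GL (Fin 2) F) : (g : Matrix (Fin 2) (Fin 2) F).det = ent g 0 0 * ent g 1 1 - ent g 0 1 * ent g 1 0 :=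
  Matrix.det_fin_two _

omit [Valued F (WithZero (Multiplicative ℤ))] in
/-- Auxiliary. [folklore] -/
theorem det_ne_zero (g : GL (Fin 2) F) : (g : Matrix (Fin 2) (Fin 2) F).det ≠ 0 := by
  rw [← Matrix.GeneralLinearGroup.val_det_apply]; exact (Matrix.GeneralLinearGroup.det g).ne_zero

omit [Valued F (WithZero (Multiplicative ℤ))] in
/-- Entries of the inverse of a `2 × 2` invertible matrix. [folklore] -/
theorem ent_inv (g : GL (Fin 2) F) :
    ent g⁻¹ 0 0 = ((g : Matrix (Fin 2) (Fin 2) F).det)⁻¹ * ent g 1 1 ∧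
    ent g⁻¹ 0 1 = -(((g : Matrix (Fin 2) (Fin 2) F).det)⁻¹ * ent g 0 1) ∧
    ent g⁻¹ 1 0 = -(((g : Matrix (Fin 2) (Fin 2) F).det)⁻¹ * ent g 1 0) ∧
    ent g⁻¹ 1 1 = ((g : Matrix (Fin 2) (Fin 2) F).det)⁻¹ * ent g 0 0 := by
  have h : ((g⁻¹ : GL (Fin 2) F) : Matrix (Fin 2) (Fin 2) F) = ((g : Matrix (Fin 2) (Fin 2) F).det)⁻¹ •
      !![ent g 1 1, -ent g 0 1; -ent g 1 0, ent g 0 0] := by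
    rw [Matrix.coe_units_inv, Matrix.inv_def, Ring.inverse_eq_inv', Matrix.adjugate_fin_two]
  simp only [ent] at h ⊢
  refine ⟨?_, ?_, ?_, ?_⟩ <;> (rw [h]; simp [Matrix.smul_apply])

/-- Auxiliary. [folklore] -/
theorem det_sub_one_le {r c : ℤ} (hc : 1 ≤ c) {g : GL (Fin 2) F} (hg : ShellCond r c g) :
    𝓋 ((g : Matrix (Fin 2) (Fin 2) F).det - 1) ≤ exp (-c) := by
  obtain ⟨h00, h11, h01, h10⟩ := hg
  have e : (g : Matrix (Fin 2) (Fin 2) F).det - 1 = (ent g 0 0 - 1) * ent g 1 1 + (ent g 1 1 - 1) + -(ent g 0 1 * ent g 1 0) := by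
    rw [det_eq]; ring
  rw [e]
  refine v_add_add_le ?_ h11 ?_
  · have := v_mul_le h00 (v_eq_one_of_sub_one hc h11).le
    rwa [mul_one] at this
  · rw [Valuation.map_neg]
    have := v_mul_le h01 h10
    rwa [← exp_add, show r + (-c - r) = -c by ring] at this

/-- Auxiliary. [folklore] -/
theorem v_det_eq_one {r c : ℤ} (hc : 1 ≤ c) {g : GL (Fin 2) F} (hg : ShellCond r c g) :
    𝓋 (g : Matrix (Fin 2) (Fin 2) F).det = 1 :=
  v_eq_one_of_sub_one hc (det_sub_one_le hc hg)

/-- Auxiliary. [folklore] -/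
theorem v_det_inv_eq_one {r c : ℤ} (hc : 1 ≤ c) {g : GL (Fin 2) F} (hg : ShellCond r c g) :
    𝓋 ((g : Matrix (Fin 2) (Fin 2) F).det)⁻¹ = 1 := by
  rw [map_inv₀, v_det_eq_one hc hg, inv_one]

/-- Closure under products. [cite: BushnellHenniart2006, §12] -/
theorem shellCond_mul {r c : ℤ} (hc : 1 ≤ c) {g h : GL (Fin 2) F} (hg : ShellCond r c g) (hh : ShellCond r c h) :
    ShellCond r c (g * h) := by
  obtain ⟨g00, g11, g01, g10⟩ := hg
  obtain ⟨h00, h11, h01, h10⟩ := hh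
  have g00' := (v_eq_one_of_sub_one hc g00).le
  have g11' := (v_eq_one_of_sub_one hc g11).le
  have h00' := (v_eq_one_of_sub_one hc h00).le
  have h11' := (v_eq_one_of_sub_one hc h11).le
  have hrc : exp r * exp (-c - r) = (exp (-c) : WithZero (Multiplicative ℤ)) := by rw [← exp_add]; congr 1; ring
  have hcr : exp (-c - r) * exp r = (exp (-c) : WithZero (Multiplicative ℤ)) := by rw [mul_comm]; exact hrc
  refine ⟨?_, ?_, ?_, ?_⟩
  · rw [ent_mul, show ent g 0 0 * ent h 0 0 + ent g 0 1 * ent h 1 0 - 1 =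
      (ent g 0 0 - 1) * ent h 0 0 + (ent h 0 0 - 1) + ent g 0 1 * ent h 1 0 by ring]
    refine v_add_add_le ?_ h00 ?_
    · exact (v_mul_le g00 h00').trans_eq (mul_one _)
    · exact (v_mul_le g01 h10).trans_eq hrc
  · rw [ent_mul, show ent g 1 0 * ent h 0 1 + ent g 1 1 * ent h 1 1 - 1 =
      ent g 1 0 * ent h 0 1 + (ent g 1 1 - 1) * ent h 1 1 + (ent h 1 1 - 1) by ring]
    refine v_add_add_le ?_ ?_ h11
    · exact (v_mul_le g10 h01).trans_eq hcr
    · exact (v_mul_le g11 h11').trans_eq (mul_one _)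
  · rw [ent_mul]
    refine v_add_le ?_ ?_
    · exact (v_mul_le g00' h01).trans_eq (one_mul _)
    · exact (v_mul_le g01 h11').trans_eq (mul_one _)
  · rw [ent_mul]
    refine v_add_le ?_ ?_
    · exact (v_mul_le g10 h00').trans_eq (mul_one _)
    · exact (v_mul_le g11' h10).trans_eq (one_mul _)

/-- Closure under inverses. [cite: BushnellHenniart2006, §12] -/
theorem shellCond_inv {r c : ℤ} (hc : 1 ≤ c) {g : GL (Fin 2) F} (hg : ShellCond r c g) : ShellCond r c g⁻¹ := by
  have hd := v_det_inv_eq_one hc hg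
  have hd1 : 𝓋 (((g : Matrix (Fin 2) (Fin 2) F).det)⁻¹ - 1) ≤ exp (-c) := by
    have e : ((g : Matrix (Fin 2) (Fin 2) F).det)⁻¹ - 1 = ((g : Matrix (Fin 2) (Fin 2) F).det)⁻¹ * (1 - (g : Matrix (Fin 2) (Fin 2) F).det) := by
      rw [mul_sub, mul_one, inv_mul_cancel₀ (det_ne_zero g)]
    rw [e, map_mul, hd, one_mul, Valuation.map_sub_swap]
    exact det_sub_one_le hc hg
  obtain ⟨g00, g11, g01, g10⟩ := hg
  obtain ⟨e00, e01, e10, e11⟩ := ent_inv g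
  set D := ((g : Matrix (Fin 2) (Fin 2) F).det)⁻¹ with hD
  refine ⟨?_, ?_, ?_, ?_⟩
  · rw [e00, show D * ent g 1 1 - 1 = D * (ent g 1 1 - 1) + (D - 1) by ring]
    refine v_add_le ?_ hd1
    rw [map_mul, hd, one_mul]; exact g11
  · rw [e11, show D * ent g 0 0 - 1 = D * (ent g 0 0 - 1) + (D - 1) by ring]
    refine v_add_le ?_ hd1
    rw [map_mul, hd, one_mul]; exact g00
  · rw [e01, Valuation.map_neg, map_mul, hd, one_mul]; exact g01
  · rw [e10, Valuation.map_neg, map_mul, hd, one_mul]; exact g10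

omit [Valued F (WithZero (Multiplicative ℤ))] in
/-- Auxiliary. [folklore] -/
theorem shellCond_one_aux : ent (1 : GL (Fin 2) F) 0 0 - 1 = 0 ∧ ent (1 : GL (Fin 2) F) 1 1 - 1 = 0 ∧
    ent (1 : GL (Fin 2) F) 0 1 = 0 ∧ ent (1 : GL (Fin 2) F) 1 0 = 0 := by
  simp [ent_one]

end ShellGL2

open ShellGL2 in
/-- **The shell subgroup** `J_{r,c} = (1 + 𝔭^c, 𝔭^{-r}; 𝔭^{c+r}, 1 + 𝔭^c) ≤ GL_2(F)` (`c ≥ 1`).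
[cite: BushnellHenniart2006, §12] -/
def shellSubgroup {F : Type*} [Field F] [Valued F (WithZero (Multiplicative ℤ))] (r c : ℤ) (hc : 1 ≤ c) :
    Subgroup (GL (Fin 2) F) where
  carrier := {g | ShellCond r c g}
  one_mem' := by
    obtain ⟨h1, h2, h3, h4⟩ := (shellCond_one_aux (F := F))
    refine ⟨?_, ?_, ?_, ?_⟩
    · rw [h1, Valuation.map_zero]; exact zero_le
    · rw [h2, Valuation.map_zero]; exact zero_le
    · rw [h3, Valuation.map_zero]; exact zero_le
    · rw [h4, Valuation.map_zero]; exact zero_le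
  mul_mem' := fun hg hh => shellCond_mul hc hg hh
  inv_mem' := fun hg => shellCond_inv hc hg

namespace ShellGL2

variable {F : Type*} [Field F] [Valued F (WithZero (Multiplicative ℤ))]

local notation "𝓋" => (Valued.v : Valuation F (WithZero (Multiplicative ℤ)))

/-- Auxiliary. [folklore] -/
theorem mem_shellSubgroup_iff {r c : ℤ} {hc : 1 ≤ c} {g : GL (Fin 2) F} :
    g ∈ shellSubgroup r c hc ↔ ShellCond r c g := Iff.rfl

/-! ### Unipotent and torus elements

We use Mathlib's `Matrix.GeneralLinearGroup.upperRightHom x = (1 x; 0 1)` (an `AddChar F (GL_2 F)`) and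
the tree's `glDiagonal 2 F ![t, 1] = diag(t, 1)` (`GLnAdelicStructure`); the local notations `𝐧 x`,
`𝐚 t` below are file-local abbreviations for them. -/

local notation "𝐧" => (Matrix.GeneralLinearGroup.upperRightHom : AddChar F (GL (Fin 2) F))
local notation "𝐚" t:max => glDiagonal 2 F ![t, 1]

omit [Valued F (WithZero (Multiplicative ℤ))] in
/-- Entries of `n(x) = (1 x; 0 1)`. [folklore] -/
theorem ent_n (x : F) : ent (𝐧 x) 0 0 = 1 ∧ ent (𝐧 x) 0 1 = x ∧ ent (𝐧 x) 1 0 = 0 ∧ ent (𝐧 x) 1 1 = 1 := by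
  refine ⟨?_, ?_, ?_, ?_⟩ <;> rfl

omit [Valued F (WithZero (Multiplicative ℤ))] in
/-- Entries of `a(t) = diag(t, 1)`. [folklore] -/
theorem ent_a (t : Fˣ) : ent (𝐚 t) 0 0 = t ∧ ent (𝐚 t) 0 1 = 0 ∧ ent (𝐚 t) 1 0 = 0 ∧ ent (𝐚 t) 1 1 = 1 := by
  refine ⟨?_, ?_, ?_, ?_⟩ <;> simp [ent, coe_glDiagonal, Matrix.diagonal]

omit [Valued F (WithZero (Multiplicative ℤ))] in
/-- `a(t)⁻¹ = a(t⁻¹)`. [folklore] -/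
theorem a_inv (t : Fˣ) : (𝐚 t)⁻¹ = 𝐚 t⁻¹ := by
  rw [← map_inv]
  congr 1
  funext k; fin_cases k <;> simp

/-- `n(x) ∈ J_{r,c}` iff `|x| ≤ e^r`. [folklore] -/
theorem n_mem_shellSubgroup {r c : ℤ} {hc : 1 ≤ c} {x : F} (hx : 𝓋 x ≤ exp r) : 𝐧 x ∈ shellSubgroup r c hc := by
  obtain ⟨e00, e01, e10, e11⟩ := ent_n x
  refine ⟨?_, ?_, ?_, ?_⟩
  · rw [e00, sub_self, Valuation.map_zero]; exact zero_le
  · rw [e11, sub_self, Valuation.map_zero]; exact zero_le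
  · rw [e01]; exact hx
  · rw [e10, Valuation.map_zero]; exact zero_le

omit [Valued F (WithZero (Multiplicative ℤ))] in
/-- Entries of `n(x) g`. [folklore] -/
theorem ent_n_mul (x : F) (g : GL (Fin 2) F) :
    ent (𝐧 x * g) 0 0 = ent g 0 0 + x * ent g 1 0 ∧ ent (𝐧 x * g) 0 1 = ent g 0 1 + x * ent g 1 1 ∧
    ent (𝐧 x * g) 1 0 = ent g 1 0 ∧ ent (𝐧 x * g) 1 1 = ent g 1 1 := by
  obtain ⟨e00, e01, e10, e11⟩ := ent_n x
  refine ⟨?_, ?_, ?_, ?_⟩ <;> simp only [ent_mul, e00, e01, e10, e11, one_mul, zero_mul, zero_add]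

omit [Valued F (WithZero (Multiplicative ℤ))] in
/-- Entries of `a(t)⁻¹ g a(t)`: `(g₁₁, t⁻¹ g₁₂; t g₂₁, g₂₂)`. [folklore] -/
theorem ent_aInv_mul_mul_a (t : Fˣ) (g : GL (Fin 2) F) :
    ent ((𝐚 t)⁻¹ * g * 𝐚 t) 0 0 = ent g 0 0 ∧ ent ((𝐚 t)⁻¹ * g * 𝐚 t) 0 1 = ((t⁻¹ : Fˣ) : F) * ent g 0 1 ∧
    ent ((𝐚 t)⁻¹ * g * 𝐚 t) 1 0 = ent g 1 0 * t ∧ ent ((𝐚 t)⁻¹ * g * 𝐚 t) 1 1 = ent g 1 1 := by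
  rw [a_inv]
  obtain ⟨a00, a01, a10, a11⟩ := ent_a t
  obtain ⟨b00, b01, b10, b11⟩ := ent_a t⁻¹
  have ht : (t : F) ≠ 0 := t.ne_zero
  refine ⟨?_, ?_, ?_, ?_⟩ <;> simp only [ent_mul, a00, a01, a10, a11, b00, b01, b10, b11, mul_zero, zero_mul, add_zero, zero_add,
    mul_one, one_mul]
  rw [Units.val_inv_eq_inv_val, mul_comm, ← mul_assoc, mul_inv_cancel₀ ht, one_mul]

/-! ### The factorisation `j = n(x) b` -/

/-- **Iwahori factorisation in the shell group**: for `j ∈ J_{r,c}` put `x = j₁₂ / j₂₂` and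
`b = n(-x) j`; then `j = n(x) b`, `|x| ≤ e^{r}`, `b₁₂ = 0`, `b₂₂ = j₂₂`, `b₂₁ = j₂₁`,
`|b₁₁ - 1| ≤ e^{-c}` and `|x (1 - j₂₂)| ≤ e^{r - c}` (so that `ψ(x) = ψ(j₁₂)` for `ψ` trivial on
`𝔭^{c-r}`: `j₁₂ - x = x (j₂₂ - 1)`). [cite: BushnellHenniart2006, §12] -/
theorem shell_factorisation {r c : ℤ} (hc : 1 ≤ c) {j : GL (Fin 2) F} (hj : ShellCond r c j) :
    let x : F := ent j 0 1 * (ent j 1 1)⁻¹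
    j = 𝐧 x * (𝐧 (-x) * j) ∧ 𝓋 x ≤ exp r ∧ ent (𝐧 (-x) * j) 0 1 = 0 ∧ ent (𝐧 (-x) * j) 1 1 = ent j 1 1 ∧
      ent (𝐧 (-x) * j) 1 0 = ent j 1 0 ∧ 𝓋 (ent (𝐧 (-x) * j) 0 0 - 1) ≤ exp (-c) ∧
      𝓋 (ent j 0 1 - x) ≤ exp (r - c) := by
  intro x
  obtain ⟨h00, h11, h01, h10⟩ := hj
  have hj11 : 𝓋 (ent j 1 1) = 1 := v_eq_one_of_sub_one hc h11
  have hj11ne : ent j 1 1 ≠ 0 := fun h0 => by rw [h0, Valuation.map_zero] at hj11; exact zero_ne_one hj11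
  have hx : 𝓋 x = 𝓋 (ent j 0 1) := by
    show 𝓋 (ent j 0 1 * (ent j 1 1)⁻¹) = _
    rw [map_mul, map_inv₀, hj11, inv_one, mul_one]
  obtain ⟨e00, e01, e10, e11⟩ := ent_n_mul (-x) j
  refine ⟨?_, hx ▸ h01, ?_, e11, e10, ?_, ?_⟩
  · rw [← mul_assoc, ← AddChar.map_add_eq_mul, add_neg_cancel, AddChar.map_zero_eq_one, one_mul]
  · rw [e01]
    show ent j 0 1 + -(ent j 0 1 * (ent j 1 1)⁻¹) * ent j 1 1 = 0
    rw [neg_mul, mul_assoc, inv_mul_cancel₀ hj11ne, mul_one, add_neg_cancel]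
  · rw [e00, show ent j 0 0 + -x * ent j 1 0 - 1 = (ent j 0 0 - 1) + -(x * ent j 1 0) by ring]
    refine v_add_le h00 ?_
    rw [Valuation.map_neg]
    have := v_mul_le (hx ▸ h01 : 𝓋 x ≤ exp r) h10
    rwa [← exp_add, show r + (-c - r) = -c by ring] at this
  · have e : ent j 0 1 - x = x * (ent j 1 1 - 1) := by
      show ent j 0 1 - ent j 0 1 * (ent j 1 1)⁻¹ = ent j 0 1 * (ent j 1 1)⁻¹ * (ent j 1 1 - 1)
      rw [mul_sub, mul_one, mul_assoc, inv_mul_cancel₀ hj11ne, mul_one]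
    rw [e]
    have := v_mul_le (hx ▸ h01 : 𝓋 x ≤ exp r) h11
    rwa [← exp_add, show r + -c = r - c by ring] at this

/-- **Additivity of `j ↦ j₁₂` modulo `𝔭^{c-r}`** on `J_{r,c}`:
`|(j j')₁₂ - j₁₂ - j'₁₂| ≤ e^{r-c}` (`(jj')₁₂ - j₁₂ - j'₁₂ = (j₁₁ - 1) j'₁₂ + j₁₂ (j'₂₂ - 1)`). [folklore] -/
theorem valued_mul_entry_sub_le {r c : ℤ} {j j' : GL (Fin 2) F} (hj : ShellCond r c j) (hj' : ShellCond r c j') :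
    𝓋 (ent (j * j') 0 1 - ent j 0 1 - ent j' 0 1) ≤ exp (r - c) := by
  obtain ⟨h00, -, h01, -⟩ := hj
  obtain ⟨-, h11', h01', -⟩ := hj'
  rw [ent_mul, show ent j 0 0 * ent j' 0 1 + ent j 0 1 * ent j' 1 1 - ent j 0 1 - ent j' 0 1 =
    (ent j 0 0 - 1) * ent j' 0 1 + ent j 0 1 * (ent j' 1 1 - 1) by ring]
  refine v_add_le ?_ ?_
  · have := v_mul_le h00 h01'
    rwa [← exp_add, show -c + r = r - c by ring] at this
  · have := v_mul_le h01 h11'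
    rwa [← exp_add, show r + -c = r - c by ring] at this

/-! ### Comparison with the principal congruence subgroups -/

/-- `J_{r,c} ≤ K(e^{-c'})` when `r ≤ -c'`, `c' ≤ c + r`, `c' ≤ c`, `0 ≤ c'`. [folklore] -/
theorem shellCond_mem_valuedCongruenceSubgroup {r c c' : ℤ} (hc : 1 ≤ c) (h1 : r ≤ -c') (h2 : c' ≤ c + r) (h3 : c' ≤ c)
    (h0 : 0 ≤ c') {g : GL (Fin 2) F} (hg : ShellCond r c g) :
    g ∈ valuedCongruenceSubgroup (Fin 2) (exp (-c') : WithZero (Multiplicative ℤ)) := by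
  -- entries of `g - 1` are `≤ e^{-c'} ≤ 1`, for `g` and for `g⁻¹`
  have key : ∀ {h : GL (Fin 2) F}, ShellCond r c h → ∀ i j, 𝓋 (((h : Matrix (Fin 2) (Fin 2) F) - 1) i j) ≤ exp (-c') := by
    intro h hh i j
    obtain ⟨a00, a11, a01, a10⟩ := hh
    rw [Matrix.sub_apply]
    fin_cases i <;> fin_cases j
    · have hh := a00.trans (exp_le_exp.2 (show -c ≤ -c' by omega)); simpa [Matrix.one_apply] using hh
    · have hh := a01.trans (exp_le_exp.2 h1); simpa [Matrix.one_apply] using hh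
    · have hh := a10.trans (exp_le_exp.2 (show -c - r ≤ -c' by omega)); simpa [Matrix.one_apply] using hh
    · have hh := a11.trans (exp_le_exp.2 (show -c ≤ -c' by omega)); simpa [Matrix.one_apply] using hh
  have hle1 : (exp (-c') : WithZero (Multiplicative ℤ)) ≤ 1 := by rw [← exp_zero, exp_le_exp]; omega
  have ent_le : ∀ {h : GL (Fin 2) F}, ShellCond r c h → ∀ i j, 𝓋 ((h : Matrix (Fin 2) (Fin 2) F) i j) ≤ 1 := by
    intro h hh i j
    have e : (h : Matrix (Fin 2) (Fin 2) F) i j = ((h : Matrix (Fin 2) (Fin 2) F) - 1) i j + (1 : Matrix (Fin 2) (Fin 2) F) i j := by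
      rw [Matrix.sub_apply, sub_add_cancel]
    rw [e]
    refine v_add_le ((key hh i j).trans hle1) ?_
    rw [Matrix.one_apply]; split_ifs <;> simp
  exact ⟨ent_le hg, ent_le (shellCond_inv hc hg), key hg⟩

/-- `K(e^{-N}) ≤ J_{r,c}` when `-N ≤ r`, `c + r ≤ N`, `c ≤ N`. [folklore] -/
theorem shellCond_of_mem_valuedCongruenceSubgroup {r c N : ℤ} (h1 : -N ≤ r) (h2 : c + r ≤ N) (h3 : c ≤ N) {g : GL (Fin 2) F}
    (hg : g ∈ valuedCongruenceSubgroup (Fin 2) (exp (-N) : WithZero (Multiplicative ℤ))) : ShellCond r c g := by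
  obtain ⟨-, -, h⟩ := hg
  have e : ∀ i j, ent g i j - (1 : Matrix (Fin 2) (Fin 2) F) i j = ((g : Matrix (Fin 2) (Fin 2) F) - 1) i j := fun i j => by
    rw [Matrix.sub_apply]
  refine ⟨?_, ?_, ?_, ?_⟩
  · have hh := (h 0 0).trans (exp_le_exp.2 (show -N ≤ -c by omega)); rw [← e] at hh; simpa [Matrix.one_apply] using hh
  · have hh := (h 1 1).trans (exp_le_exp.2 (show -N ≤ -c by omega)); rw [← e] at hh; simpa [Matrix.one_apply] using hh
  · have hh := (h 0 1).trans (exp_le_exp.2 h1); rw [← e] at hh; simpa [Matrix.one_apply] using hh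
  · have hh := (h 1 0).trans (exp_le_exp.2 (show -N ≤ -c - r by omega)); rw [← e] at hh; simpa [Matrix.one_apply] using hh

/-- **The conjugated lower-triangular factor lies in the level group**: if `b₁₂ = 0`,
`|b₁₁ - 1|, |b₂₂ - 1| ≤ e^{-c}`, `|b₂₁| ≤ e^{-c-r}`, `|t| ≤ e^{-m}` with `c ≥ 2 c₀`, `c₀ ≥ 0`, `c ≥ 1` and
`m ≥ -r - c₀`, then `a(t)⁻¹ b a(t) ∈ K(e^{-c₀})`. [folklore] -/
theorem aInv_mul_mul_a_mem_valuedCongruenceSubgroup {r c c₀ m : ℤ} (hc : 1 ≤ c) (hcc : 2 * c₀ ≤ c) (h0 : 0 ≤ c₀)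
    (hm : -r - c₀ ≤ m) {b : GL (Fin 2) F} (hb01 : ent b 0 1 = 0) (hb00 : 𝓋 (ent b 0 0 - 1) ≤ exp (-c))
    (hb11 : 𝓋 (ent b 1 1 - 1) ≤ exp (-c)) (hb10 : 𝓋 (ent b 1 0) ≤ exp (-c - r)) {t : Fˣ} (ht : 𝓋 (t : F) ≤ exp (-m)) :
    (𝐚 t)⁻¹ * b * 𝐚 t ∈ valuedCongruenceSubgroup (Fin 2) (exp (-c₀) : WithZero (Multiplicative ℤ)) := by
  obtain ⟨e00, e01, e10, e11⟩ := ent_aInv_mul_mul_a t b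
  -- the conjugate lies in `J_{-c₀, c}`
  have hcond : ShellCond (-c₀) c ((𝐚 t)⁻¹ * b * 𝐚 t) := by
    refine ⟨by rw [e00]; exact hb00, by rw [e11]; exact hb11, by rw [e01, hb01, mul_zero, Valuation.map_zero]; exact zero_le, ?_⟩
    rw [e10]
    have := v_mul_le hb10 ht
    refine this.trans ?_
    rw [← exp_add, exp_le_exp]; omega
  exact shellCond_mem_valuedCongruenceSubgroup hc (by omega) (by omega) (by omega) h0 hcond

end ShellGL2

end Literature.NumberTheory.Automorphic
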